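import Mathlib
import Summits.NavierStokesRegularity.NavierStokesRegularity.Theses.ClockStretchingLaw
import Summits.NavierStokesRegularity.NavierStokesRegularity.Theorems.ClockStretchingLawClockCeilingFarPastStretchingRung
import Literature.Analysis.FluidPDE.TypeIAncientMild
import Literature.Analysis.FluidPDE.CurlFreeLiouville
import HarnessLib

/-!
# Route ClockStretchingLaw, crux `ClockCeiling` (stmt-NavierStokesRegularity-10570) — the
# INTEGRATED far-past stretching rung (Lyapunov-weight form)

The sharp, time-averaged form of the far-past stretching rung `farPastStretchingRung`
(p159076): the gauge stretching rate along the vorticity direction of a nonzero Type-I ancient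
mild field must exceed every `θ < 1` in the far past by a NON-INTEGRABLE amount in logarithmic
time `s = −log(−t)`.

**`farPastIntegrableExcessRung`.** Let `u ∈ A_C` (`IsTypeIAncientMild C u`), `T ≤ 0`, `θ < 1`,
and let `H : ℝ → ℝ` be smooth and BOUNDED BELOW. If at every `(t, x)` with `t < T` and
`ω(t,x) ≠ 0`
`(−t) ⟪∇u(t,x) ξ, ξ⟫ ≤ θ + (−t) H'(t)` (`ξ = ω/|ω|`),
then `u ≡ 0` on `t < 0`. With `H ≡ 0` this is `farPastStretchingRung`; in general
`(−t)H'(t) = dH/ds` is the `s`-derivative of a bounded-below function, so the hypothesis says that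
the excess `(sup_{ω≠0} (−t)⟪Sξ,ξ⟫ − θ)⁺` is dominated by an `L¹(ds)` density as `s → −∞`:
**every nonzero element of `A_C` has `∫_{−∞} (sup_{ω≠0}(−t)⟪Sξ,ξ⟫ − θ)⁺ ds = +∞` for every
`θ < 1`** (contrapositive, for excesses admitting a smooth integrable majorant).

## Proof

The weighted vorticity maximum principle of route `SymmetryModuliCount`
(`stretchCert_curl_eq_zero`) with the purely temporal LYAPUNOV WEIGHT
`h(t) = exp(H(t + T) − B) ≥ 1` (`B = inf H`) on the backward shift `v = u(· + T) ∈ A_C`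
(`IsTypeIAncientMild.comp_sub_right`): `∇h = 0`, `Δh = 0`, `∂ₜh = H'(t+T) h`, and since
`−t ≤ −(t+T)` the hypothesis gives the certificate inequality
`((−t)(α − |∇ξ|²) − 1 + (1 − max θ 0)) h ≤ (−t) ∂ₜh` wherever `ω_v ≠ 0`
(`farPastIntegrableExcess_cert_ineq`). Hence `curl v ≡ 0`, the slices of `v` are constant
(KNSS 2009 Lemma 3.1) and vanish (Remark 6.1), i.e. `u ≡ 0` before `T`, and forward uniqueness
(`vanishes_of_vanishes_before`) finishes.

## References

* G. Koch, N. Nadirashvili, G. Seregin, V. Šverák, Acta Math. 203 (2009) 83–105, Lemma 3.1,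
  Prop. 4.1, Remark 6.1 (arXiv:0709.3599). [KochNadirashviliSereginSverak2009]
* P. Constantin, C. Fefferman, Indiana Univ. Math. J. 42 (1993) 775–789, §1. [ConstantinFefferman1993]
-/

noncomputable section

-- the summit and its single sub-problem share the name (CONVENTIONS §1), as in every Theorems file
set_option linter.dupNamespace false

open Set Function Filter
open scoped RealInnerProductSpace Laplacian ContDiff Topology

namespace Summit.NavierStokesRegularity.NavierStokesRegularity.Theorems

open Literature.Analysis Literature.Analysis.FluidPDE
open Summit.NavierStokesRegularity.NavierStokesRegularity.Theorems.SymmetryModuliCountSymmetricLiouville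

/-- **The certificate inequality for a temporal Lyapunov weight.** If `0 < -s`, `-s ≤ -r`,
`(-r) * a ≤ θ + (-r) * d` with `0 ≤ θ`, `0 ≤ F` and `0 < h`, then
`((−s)(a − F) − 1 + (1 − θ)) h ≤ (−s)(d h + 0 − 0)`. [folklore] -/
theorem farPastIntegrableExcess_cert_ineq {s r a d θ F h : ℝ} (hs : 0 < -s) (hsr : -s ≤ -r)
    (ha : (-r) * a ≤ θ + (-r) * d) (hθ : 0 ≤ θ) (hF : 0 ≤ F) (hh : 0 < h) :
    ((-s) * (a - F) - 1 + (1 - θ)) * h ≤ (-s) * (d * h + 0 - 0) := by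
  have hsa : (-s) * (a - d) ≤ θ := by
    have ha' : (-r) * (a - d) ≤ θ := by nlinarith
    rcases le_or_gt 0 (a - d) with had | had
    · exact (mul_le_mul_of_nonneg_right hsr had).trans ha'
    · have : (-s) * (a - d) ≤ 0 := mul_nonpos_of_nonneg_of_nonpos hs.le had.le
      linarith
  have h1 : (-s) * (a - F) - 1 + (1 - θ) ≤ (-s) * d := by nlinarith [mul_nonneg hs.le hF]
  nlinarith

/-- **Integrated far-past rung ⇒ vanishing before `T`.** If `u ∈ A_C` and, for some `T ≤ 0`,
`θ < 1` and a smooth `H` bounded below by `B`,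
`(−t)⟪∇u(t,x) ξ, ξ⟫ ≤ θ + (−t) H'(t)` wherever `t < T` and `curl u(t,x) ≠ 0`, then `u(t,·) ≡ 0`
for every `t < T` (Lyapunov weight `h = exp(H(· + T) − B)` in `stretchCert_curl_eq_zero` on the
backward shift, then KNSS 2009 Lemma 3.1 and Remark 6.1). [cite: KochNadirashviliSereginSverak2009, Lemma 3.1 and Remark 6.1 (arXiv:0709.3599)] -/
theorem farPastIntegrableExcessRung_vanishes_before {C : ℝ}
    {u : ℝ → EuclideanSpace ℝ (Fin 3) → EuclideanSpace ℝ (Fin 3)} (hu : IsTypeIAncientMild C u)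
    {T θ : ℝ} (hT : T ≤ 0) (hθ : θ < 1) {H : ℝ → ℝ} (hH : ContDiff ℝ ∞ H) {B : ℝ}
    (hHB : ∀ t, B ≤ H t)
    (hst : ∀ t < T, ∀ x, curl (u t) x ≠ 0 →
      (-t) * ⟪fderiv ℝ (u t) x (vorticityDirection (curl (u t)) x),
        vorticityDirection (curl (u t)) x⟫ ≤ θ + (-t) * deriv H t) :
    ∀ t < T, ∀ x, u t x = 0 := by
  -- WLOG `0 ≤ θ`
  set θ' : ℝ := max θ 0 with hθ'
  have hθ'0 : 0 ≤ θ' := le_max_right _ _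
  have hθ'1 : θ' < 1 := max_lt hθ one_pos
  -- the backward shift `v t = u (t + T)` is again in the class
  set v : ℝ → EuclideanSpace ℝ (Fin 3) → EuclideanSpace ℝ (Fin 3) := fun t => u (t - -T) with hvdef
  have hv : IsTypeIAncientMild C v := hu.comp_sub_right (by linarith)
  -- the Lyapunov weight `h(t, y) = exp (H (t + T) - B) ≥ 1`
  set h : ℝ → EuclideanSpace ℝ (Fin 3) → ℝ := fun t _ => Real.exp (H (t - -T) - B) with hhdef
  have hHd : Differentiable ℝ H := hH.differentiable (by simp)
  have hh : IsSmoothSpaceTimeOn (Iio 0) h := by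
    have hc : ContDiff ℝ ∞ (uncurry h) := by
      have e : uncurry h = fun p : ℝ × EuclideanSpace ℝ (Fin 3) => Real.exp (H (p.1 - -T) - B) := by
        funext p; rfl
      rw [e]
      exact Real.contDiff_exp.comp ((hH.comp (contDiff_fst.sub contDiff_const)).sub contDiff_const)
    exact hc.contDiffOn
  have hhpos : ∀ s (y : EuclideanSpace ℝ (Fin 3)), 0 < h s y := fun s y => Real.exp_pos _
  have hh1 : ∀ s < (0 : ℝ), ∀ (y : EuclideanSpace ℝ (Fin 3)), 1 ≤ h s y := fun s _ y =>
    Real.one_le_exp (sub_nonneg.2 (hHB _))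
  have hgrad1 : ∀ s < (0 : ℝ), ∀ (y : EuclideanSpace ℝ (Fin 3)),
      ‖fderiv ℝ (h s) y‖ ≤ 0 * (1 / Real.sqrt (-s) + ‖y‖ / (-s)) * h s y := by
    intro s _ y
    simp [hhdef]
  -- the time derivative of the weight
  have htd : ∀ s (y : EuclideanSpace ℝ (Fin 3)),
      timeDeriv h s y = deriv H (s - -T) * h s y := by
    intro s y
    rw [timeDeriv_apply]
    have h1 : HasDerivAt (fun σ : ℝ => H (σ - -T) - B) (deriv H (s - -T)) s := by
      have := ((hHd (s - -T)).hasDerivAt.comp_sub_const s (-T)).sub_const B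
      simpa using this
    have h2 := h1.exp
    rw [h2.deriv]
    simp only [hhdef]
    ring
  have hcert : ∀ s < (0 : ℝ), ∀ (y : EuclideanSpace ℝ (Fin 3)), curl (v s) y ≠ 0 →
      ((-s) * (⟪fderiv ℝ (v s) y (vorticityDirection (curl (v s)) y),
          vorticityDirection (curl (v s)) y⟫
          - frobeniusNormSq (fderiv ℝ (vorticityDirection (curl (v s))) y)) - 1 + (1 - θ')) *
          h s y ≤
        (-s) * (timeDeriv h s y + fderiv ℝ (h s) y (v s y) - (Δ (h s)) y) := by
    intro s hs y hω
    have hfd : fderiv ℝ (h s) y (v s y) = 0 := by simp [hhdef]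
    have hΔ : (Δ (h s)) y = 0 := laplacian_const_eq_zero (Real.exp (H (s - -T) - B)) y
    rw [htd, hfd, hΔ]
    -- the hypothesis at the earlier time `s + T < T`
    have hsT : s - -T < T := by linarith
    have hω' : curl (u (s - -T)) y ≠ 0 := hω
    have key := hst (s - -T) hsT y hω'
    have key' : (-(s - -T)) * ⟪fderiv ℝ (v s) y (vorticityDirection (curl (v s)) y),
        vorticityDirection (curl (v s)) y⟫ ≤ θ' + (-(s - -T)) * deriv H (s - -T) :=
      key.trans (by gcongr; exact le_max_left _ _)
    exact farPastIntegrableExcess_cert_ineq (neg_pos.2 hs) (by linarith) key' hθ'0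
      (frobeniusNormSq_nonneg _) (hhpos s y)
  have hω : ∀ s < 0, ∀ y, curl (v s) y = 0 := fun s hs y =>
    stretchCert_curl_eq_zero hv hh hh1 (by linarith : (0 : ℝ) < 1 - θ') hgrad1 hcert hs y
  have hub : ∀ s < 0, ∀ y, v s y = v s 0 := fun s hs y =>
    eq_of_curl_eq_zero_of_isDivFree_of_bounded ((hv.contDiff_slice hs).of_le (by norm_cast))
      (hω s hs) (hv.isDivFree hs) (fun z => hv.norm_le hs z) y 0
  have hv0 : ∀ s < 0, ∀ y, v s y = 0 := fun s hs y => hv.eq_zero_of_slice_const hub hs y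
  intro t ht x
  have key := hv0 (t - T) (by linarith) x
  simpa [hvdef] using key

/-- **The integrated far-past stretching rung (Lyapunov-weight form; portrait clause of the
Type-I Liouville node / crux `ClockCeiling`).** For every `u ∈ A_C`: if for some `T ≤ 0`, some
`θ < 1` and some smooth `H : ℝ → ℝ` bounded below, the gauge stretching rate along the
vorticity direction obeys `(−t)⟪∇u(t,x) ξ, ξ⟫ ≤ θ + (−t) H'(t)` at every `(t, x)` with `t < T`
and `curl u(t,x) ≠ 0`, then `u ≡ 0` on `t < 0`. Contrapositive: along every NONZERO Type-I
KNSS-mild ancient field the excess of `sup_{ω≠0}(−t)⟪Sξ,ξ⟫` over any `θ < 1` is not dominated by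
the logarithmic-time derivative of any bounded-below smooth function as `t → −∞` ("non-integrable
excess in `s = −log(−t)`"). [cite: KochNadirashviliSereginSverak2009, Lemma 3.1, Prop. 4.1, Remark 6.1 (arXiv:0709.3599)] -/
theorem farPastIntegrableExcessRung {C : ℝ}
    {u : ℝ → EuclideanSpace ℝ (Fin 3) → EuclideanSpace ℝ (Fin 3)} (hu : IsTypeIAncientMild C u)
    {T θ : ℝ} (hT : T ≤ 0) (hθ : θ < 1) {H : ℝ → ℝ} (hH : ContDiff ℝ ∞ H) {B : ℝ}
    (hHB : ∀ t, B ≤ H t)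
    (hst : ∀ t < T, ∀ x, curl (u t) x ≠ 0 →
      (-t) * ⟪fderiv ℝ (u t) x (vorticityDirection (curl (u t)) x),
        vorticityDirection (curl (u t)) x⟫ ≤ θ + (-t) * deriv H t) :
    ∀ t < 0, ∀ x, u t x = 0 := by
  have hz : ∀ t < T - 1, ∀ x, u t x = 0 := fun t ht x =>
    farPastIntegrableExcessRung_vanishes_before hu hT hθ hH hHB hst t (by linarith) x
  exact vanishes_of_vanishes_before hu (by linarith : T - 1 < 0) hz

/-- **Stub `stub_farPastIntegrableExcessRung` (crux stmt-NavierStokesRegularity-10570, line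
`registered`, portrait clause), in the vocabulary of the route's class** (the hypotheses of
`SmallStrainRung`, i.e. `IsTypeIAncientMild` with the Oseen–Koch–Tataru kernel written out): a
smooth divergence-free KNSS-mild ancient field with `|u| ≤ C/√(−t)` whose gauge stretching rate
along the vorticity direction is `≤ θ + (−t)H'(t)` in the far past `t < T ≤ 0`, for some `θ < 1`
and some smooth `H` bounded below, vanishes identically. [cite: KochNadirashviliSereginSverak2009, Lemma 3.1, Prop. 4.1, Remark 6.1 (arXiv:0709.3599)] -/
theorem stub_farPastIntegrableExcessRung :
    ∀ (C T θ B : ℝ) (H : ℝ → ℝ) (u : ℝ → EuclideanSpace ℝ (Fin 3) → EuclideanSpace ℝ (Fin 3)), T ≤ 0 → θ < 1 →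
      ContDiff ℝ (⊤ : ℕ∞) H → (∀ t, B ≤ H t) →
      (ContDiffOn ℝ (⊤ : ℕ∞) (Function.uncurry u) (Set.Iio 0 ×ˢ Set.univ) ∧
      (∀ t < 0, Literature.Analysis.FluidPDE.VectorCalculus.IsDivFree (u t)) ∧
      (∀ s t : ℝ, s < t → t < 0 → ∀ x, u t x =
        Literature.Analysis.FluidPDE.heatFlow (u s) (t - s) x -
          ∫ τ in Set.Ioo s t, ∫ y,
            ((-(inner ℝ (x - y) (u τ y) / (2 * (t - τ)) *
                Literature.Analysis.UnboundedOperators.heatKernel (t - τ) (x - y))) • u τ y +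
              (∫ σ in Set.Ioi (t - τ),
                  Literature.Analysis.UnboundedOperators.heatKernel σ (x - y) / (4 * σ ^ 2)) •
                (inner ℝ (x - y) (u τ y) • u τ y + inner ℝ (u τ y) (u τ y) • (x - y) +
                  inner ℝ (x - y) (u τ y) • u τ y) -
              ((∫ σ in Set.Ioi (t - τ),
                  Literature.Analysis.UnboundedOperators.heatKernel σ (x - y) / (8 * σ ^ 3)) *
                (inner ℝ (x - y) (u τ y) * inner ℝ (x - y) (u τ y))) • (x - y))) ∧
      Literature.Analysis.FluidPDE.HasTypeITimeDecay C u) →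
      (∀ t < T, ∀ x, Literature.Analysis.FluidPDE.curl (u t) x ≠ 0 →
        (-t) * inner ℝ (fderiv ℝ (u t) x
          (Literature.Analysis.FluidPDE.vorticityDirection (Literature.Analysis.FluidPDE.curl (u t)) x))
          (Literature.Analysis.FluidPDE.vorticityDirection (Literature.Analysis.FluidPDE.curl (u t)) x)
          ≤ θ + (-t) * deriv H t) →
      ∀ t < 0, ∀ x, u t x = 0 := by
  intro C T θ B H u hT hθ hH hHB hu hst
  exact farPastIntegrableExcessRung (smallStrainRung_isTypeIAncientMild hu) hT hθ hH hHB hst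

end Summit.NavierStokesRegularity.NavierStokesRegularity.Theorems

end
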